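import Summits.Ventures.PercRepro.C041TriDomStockedHost
import Summits.Ventures.PercRepro.C041TriDomAnchoredReductions

/-!
# ROW C-041 — THEOREM (TWO MARK EDGES): A HOST WITH TWO EDGES AMONG ITS MARKS SATISFIES THE CONJECTURE
(p6, gen 47; P6-TWOEXIT-LEAN.md §53 ADDENDUM 20)

A PRESENT edge joining two marks connects them in red or in blue in every colouring (`rdS_or_mgS_of_present`), so
it empties every crossed class in which that pair is connected in NEITHER colour: an edge `x–y` empties `(s₂,s₃)`
(`not_c23_of_edge_xy`), an edge `x–z` empties `(s₃,s₁)` and `(s₁,s₃)`, an edge `y–z` empties `(s₁,s₂)`.  With TWO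
present mark edges a single crossed class survives, and a single class is dominated on every up-set by THEOREM
(TWO-MARK DOMINATION) in its status form (`cntB_le_cntR`): the per-class theorems of ADDENDUM 15 on ANY status
(`class12S_le_topBotS`, `class23S_le_topBotS`, `class31S_le_topBotS`, `class13S_le_topBotS`, through the shape
lemma `classS_le_of_shape` and `count_blue_only_le_count_red_only_st`).  **THEOREM (TWO MARK EDGES)**
(`cycDominationS_of_twoMarkEdges`, `ancDominationS_of_twoMarkEdges`; all-free forms
`cycDomination_of_twoMarkEdges`, `ancDomination_of_twoMarkEdges`): on every status with present edges joining two of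
the three pairs of marks, both orientations of CONJECTURE (STOCHASTIC DOMINATION) hold.  READING: together with the
triangle (ADDENDUM 15 cont. 3) the open core has AT MOST ONE edge among its marks — the diamond `K₄ − e` of
ADDENDUM 17 (marks `x` adjacent to `y` and `z`) is a theorem, and so are every host on `≤ 5` vertices that is
3-connected after the 2-cut rules.
-/

namespace PercRepro

namespace ZoneZ

namespace MultiExit

open ZoneData Finset Classical

variable {V₁ E₁ U₁ U₂ : Type} (Z₁ : ZoneData V₁ E₁ U₁ U₂) (st : E₁ → EStat)

/-! ## Blue connectivity is antitone, on any status -/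

/-- Blue connectivity is antitone in the colouring, for any status. -/
theorem MgS_anti_st {ω ω' : E₁ → Bool} (h : LeCol ω ω') {k v : V₁} (hb : MgS Z₁ st ω' k v) :
    MgS Z₁ st ω k v := by
  unfold MgS at hb ⊢
  refine reach_mono (fun x y hxy => ?_) hb
  obtain ⟨e, hj, he⟩ := hxy
  refine ⟨e, hj, ?_⟩
  unfold blueE at he ⊢
  rcases he with he | ⟨hf, he⟩
  · exact Or.inl he
  · refine Or.inr ⟨hf, ?_⟩
    by_contra hc
    have : ω e = true := by
      cases hω : ω e
      · exact absurd hω hc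
      · rfl
    rw [h e this] at he
    exact Bool.noConfusion he

/-- A present edge joining `a` and `b` connects them in red or in blue. -/
theorem rdS_or_mgS_of_present (ω : E₁ → Bool) {e : E₁} {a b : V₁} (he : presE st e) (hj : Z₁.Joins e a b) :
    RdS Z₁ st ω a b ∨ MgS Z₁ st ω a b := by
  unfold presE at he
  unfold RdS MgS
  rw [mem_reach_singleton, mem_reach_singleton]
  cases hst : st e with
  | absent => exact absurd hst he
  | double =>
    exact Or.inl (Relation.ReflTransGen.single ⟨e, hj, Or.inl hst⟩)
  | free =>
    cases hω : ω e
    · exact Or.inr (Relation.ReflTransGen.single ⟨e, hj, Or.inr ⟨hst, hω⟩⟩)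
    · exact Or.inl (Relation.ReflTransGen.single ⟨e, hj, Or.inr ⟨hst, hω⟩⟩)

/-! ## The two-mark domination in its exclusive status form -/

section Counts

variable [Fintype E₁] [DecidableEq E₁] (x y z : V₁)

/-- THEOREM (TWO-MARK DOMINATION) on any status, card form. -/
theorem count_blue_le_count_red_st {V : (E₁ → Bool) → Prop} (hV : UpSet V) :
    (univ.filter fun ω : E₁ → Bool => V ω ∧ MgS Z₁ st ω x z).card ≤
      (univ.filter fun ω : E₁ → Bool => V ω ∧ RdS Z₁ st ω x z).card := by
  have h := cntB_le_cntR Z₁ x z st hV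
  unfold cntB cntR at h
  rw [Finset.card_filter, Finset.card_filter]
  exact_mod_cast h

/-- The exclusive form on any status: «blue-connected and not red-connected» is outnumbered by «red-connected and
not blue-connected» on every up-set. -/
theorem count_blue_only_le_count_red_only_st {V : (E₁ → Bool) → Prop} (hV : UpSet V) :
    (univ.filter fun ω : E₁ → Bool => V ω ∧ (MgS Z₁ st ω x z ∧ ¬ RdS Z₁ st ω x z)).card ≤
      (univ.filter fun ω : E₁ → Bool => V ω ∧ (RdS Z₁ st ω x z ∧ ¬ MgS Z₁ st ω x z)).card := by
  have h := count_blue_le_count_red_st Z₁ st x z hV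
  have hB : (univ.filter fun ω : E₁ → Bool => V ω ∧ MgS Z₁ st ω x z).card =
      (univ.filter fun ω : E₁ → Bool => V ω ∧ (MgS Z₁ st ω x z ∧ ¬ RdS Z₁ st ω x z)).card
        + (univ.filter fun ω : E₁ → Bool => V ω ∧ (MgS Z₁ st ω x z ∧ RdS Z₁ st ω x z)).card := by
    rw [← Finset.card_union_of_disjoint]
    · congr 1
      ext ω
      simp only [Finset.mem_filter, Finset.mem_univ, true_and, Finset.mem_union]
      tauto
    · rw [Finset.disjoint_left]
      intro ω h1 h2
      simp only [Finset.mem_filter, Finset.mem_univ, true_and] at h1 h2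
      exact h1.2.2 h2.2.2
  have hR : (univ.filter fun ω : E₁ → Bool => V ω ∧ RdS Z₁ st ω x z).card =
      (univ.filter fun ω : E₁ → Bool => V ω ∧ (RdS Z₁ st ω x z ∧ ¬ MgS Z₁ st ω x z)).card
        + (univ.filter fun ω : E₁ → Bool => V ω ∧ (MgS Z₁ st ω x z ∧ RdS Z₁ st ω x z)).card := by
    rw [← Finset.card_union_of_disjoint]
    · congr 1
      ext ω
      simp only [Finset.mem_filter, Finset.mem_univ, true_and, Finset.mem_union]
      tauto
    · rw [Finset.disjoint_left]
      intro ω h1 h2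
      simp only [Finset.mem_filter, Finset.mem_univ, true_and] at h1 h2
      exact h1.2.2 h2.2.1
  omega

/-! ## Each crossed class is dominated, on any status -/

/-- The generic step on a status: a class inside an up-set `W ∩ {p ~_B q, p ≁_R q}` whose `W ∩ {p ~_R q, p ≁_B q}`
lies in `(⊤, ⊥)` is dominated on every up-set. -/
theorem classS_le_of_shape (p q : V₁) (C W : (E₁ → Bool) → Prop) (hW : UpSet W)
    (hC : ∀ ω, C ω → W ω ∧ MgS Z₁ st ω p q ∧ ¬ RdS Z₁ st ω p q)
    (hT : ∀ ω, W ω → RdS Z₁ st ω p q → ¬ MgS Z₁ st ω p q → TopBotS Z₁ x y z st ω)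
    {V : (E₁ → Bool) → Prop} (hV : UpSet V) :
    (univ.filter fun ω : E₁ → Bool => V ω ∧ C ω).card ≤
      (univ.filter fun ω : E₁ → Bool => V ω ∧ TopBotS Z₁ x y z st ω).card := by
  have hVW : UpSet fun ω : E₁ → Bool => V ω ∧ W ω := fun ω ω' h hle => ⟨hV ω ω' h.1 hle, hW ω ω' h.2 hle⟩
  have h : (univ.filter fun ω : E₁ → Bool => (V ω ∧ W ω) ∧ MgS Z₁ st ω p q ∧ ¬ RdS Z₁ st ω p q).card ≤
      (univ.filter fun ω : E₁ → Bool => (V ω ∧ W ω) ∧ RdS Z₁ st ω p q ∧ ¬ MgS Z₁ st ω p q).card := by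
    convert count_blue_only_le_count_red_only_st Z₁ st p q hVW
  refine le_trans (Finset.card_le_card fun ω hω => ?_) (le_trans h (Finset.card_le_card fun ω hω => ?_))
  · rw [Finset.mem_filter] at hω ⊢
    obtain ⟨hu, hVω, hCω⟩ := hω
    obtain ⟨hWω, hM, hR⟩ := hC ω hCω
    exact ⟨hu, ⟨hVω, hWω⟩, hM, hR⟩
  · rw [Finset.mem_filter] at hω ⊢
    obtain ⟨hu, ⟨hVω, hWω⟩, hR, hM⟩ := hω
    exact ⟨hu, hVω, hT ω hWω hR hM⟩

/-- The class `(s₁,s₂)` in the six connectivities. -/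
def C12S (ω : E₁ → Bool) : Prop :=
  (RdS Z₁ st ω x y ∧ ¬ RdS Z₁ st ω x z ∧ ¬ RdS Z₁ st ω y z) ∧
    (¬ MgS Z₁ st ω x y ∧ MgS Z₁ st ω x z ∧ ¬ MgS Z₁ st ω y z)

/-- The class `(s₂,s₃)` in the six connectivities. -/
def C23S (ω : E₁ → Bool) : Prop :=
  (¬ RdS Z₁ st ω x y ∧ RdS Z₁ st ω x z ∧ ¬ RdS Z₁ st ω y z) ∧
    (¬ MgS Z₁ st ω x y ∧ ¬ MgS Z₁ st ω x z ∧ MgS Z₁ st ω y z)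

/-- The class `(s₃,s₁)` in the six connectivities. -/
def C31S (ω : E₁ → Bool) : Prop :=
  (¬ RdS Z₁ st ω x y ∧ ¬ RdS Z₁ st ω x z ∧ RdS Z₁ st ω y z) ∧
    (MgS Z₁ st ω x y ∧ ¬ MgS Z₁ st ω x z ∧ ¬ MgS Z₁ st ω y z)

/-- The class `(s₁,s₃)` (the anchored orientation's fourth class) in the six connectivities. -/
def C13S (ω : E₁ → Bool) : Prop :=
  (RdS Z₁ st ω x y ∧ ¬ RdS Z₁ st ω x z ∧ ¬ RdS Z₁ st ω y z) ∧
    (¬ MgS Z₁ st ω x y ∧ ¬ MgS Z₁ st ω x z ∧ MgS Z₁ st ω y z)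

omit [Fintype E₁] [DecidableEq E₁] in
/-- The crossed classes of a status are the three classes above. -/
theorem cycCrossedS_iff_classes (ω : E₁ → Bool) :
    CycCrossedS Z₁ x y z st ω ↔ C12S Z₁ st x y z ω ∨ C23S Z₁ st x y z ω ∨ C31S Z₁ st x y z ω := by
  rw [cycCrossedS_iff]
  exact Iff.rfl

omit [Fintype E₁] [DecidableEq E₁] in
/-- The anchored crossed classes of a status are `(s₁,s₂)`, `(s₂,s₃)`, `(s₁,s₃)`. -/
theorem ancCrossedS_iff_classes (ω : E₁ → Bool) :
    AncCrossedS Z₁ x y z st ω ↔ C12S Z₁ st x y z ω ∨ C23S Z₁ st x y z ω ∨ C13S Z₁ st x y z ω := by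
  rw [ancCrossedS_iff]
  exact Iff.rfl

omit [Fintype E₁] [DecidableEq E₁] in
/-- `(⊤, ⊥)` in the six connectivities, from the red ones and the absence of blue ones. -/
theorem topBotS_of_conn (ω : E₁ → Bool) (h1 : RdS Z₁ st ω x y) (h2 : RdS Z₁ st ω x z) (h3 : RdS Z₁ st ω y z)
    (h4 : ¬ MgS Z₁ st ω x y) (h5 : ¬ MgS Z₁ st ω x z) (h6 : ¬ MgS Z₁ st ω y z) : TopBotS Z₁ x y z st ω :=
  (topBotS_iff Z₁ x y z st ω).mpr ⟨⟨h1, h2, h3⟩, h4, h5, h6⟩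

/-- **THE CLASS `(s₁,s₂)` IS DOMINATED** on any status. -/
theorem class12S_le_topBotS {V : (E₁ → Bool) → Prop} (hV : UpSet V) :
    (univ.filter fun ω : E₁ → Bool => V ω ∧ C12S Z₁ st x y z ω).card ≤
      (univ.filter fun ω : E₁ → Bool => V ω ∧ TopBotS Z₁ x y z st ω).card := by
  let W : (E₁ → Bool) → Prop := fun ω => RdS Z₁ st ω x y ∧ ¬ MgS Z₁ st ω x y ∧ ¬ MgS Z₁ st ω y z
  have hW : UpSet W := fun ω ω' h hle =>
    ⟨RdS_mono_st Z₁ st hle h.1, fun hb => h.2.1 (MgS_anti_st Z₁ st hle hb), fun hb => h.2.2 (MgS_anti_st Z₁ st hle hb)⟩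
  refine classS_le_of_shape Z₁ st x y z x z _ W hW ?_ ?_ hV
  · intro ω ⟨hr, hb⟩
    exact ⟨⟨hr.1, hb.1, hb.2.2⟩, hb.2.1, hr.2.1⟩
  · intro ω ⟨h1, h2, h3⟩ hR hM
    exact topBotS_of_conn Z₁ st x y z ω h1 hR (RdS_trans_st Z₁ st ω h1 hR) h2 hM h3

/-- **THE CLASS `(s₂,s₃)` IS DOMINATED** on any status. -/
theorem class23S_le_topBotS {V : (E₁ → Bool) → Prop} (hV : UpSet V) :
    (univ.filter fun ω : E₁ → Bool => V ω ∧ C23S Z₁ st x y z ω).card ≤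
      (univ.filter fun ω : E₁ → Bool => V ω ∧ TopBotS Z₁ x y z st ω).card := by
  let W : (E₁ → Bool) → Prop := fun ω => RdS Z₁ st ω x z ∧ ¬ MgS Z₁ st ω x z ∧ ¬ MgS Z₁ st ω x y
  have hW : UpSet W := fun ω ω' h hle =>
    ⟨RdS_mono_st Z₁ st hle h.1, fun hb => h.2.1 (MgS_anti_st Z₁ st hle hb), fun hb => h.2.2 (MgS_anti_st Z₁ st hle hb)⟩
  refine classS_le_of_shape Z₁ st x y z y z _ W hW ?_ ?_ hV
  · intro ω ⟨hr, hb⟩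
    exact ⟨⟨hr.2.1, hb.2.1, hb.1⟩, hb.2.2, hr.2.2⟩
  · intro ω ⟨h1, h2, h3⟩ hR hM
    exact topBotS_of_conn Z₁ st x y z ω (RdS_trans_st Z₁ st ω ((RdS_comm Z₁ st ω x z).mp h1)
      ((RdS_comm Z₁ st ω y z).mp hR)) h1 hR h3 h2 hM

/-- **THE CLASS `(s₃,s₁)` IS DOMINATED** on any status. -/
theorem class31S_le_topBotS {V : (E₁ → Bool) → Prop} (hV : UpSet V) :
    (univ.filter fun ω : E₁ → Bool => V ω ∧ C31S Z₁ st x y z ω).card ≤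
      (univ.filter fun ω : E₁ → Bool => V ω ∧ TopBotS Z₁ x y z st ω).card := by
  let W : (E₁ → Bool) → Prop := fun ω => RdS Z₁ st ω y z ∧ ¬ MgS Z₁ st ω y z ∧ ¬ MgS Z₁ st ω x z
  have hW : UpSet W := fun ω ω' h hle =>
    ⟨RdS_mono_st Z₁ st hle h.1, fun hb => h.2.1 (MgS_anti_st Z₁ st hle hb), fun hb => h.2.2 (MgS_anti_st Z₁ st hle hb)⟩
  refine classS_le_of_shape Z₁ st x y z x y _ W hW ?_ ?_ hV
  · intro ω ⟨hr, hb⟩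
    exact ⟨⟨hr.2.2, hb.2.2, hb.2.1⟩, hb.1, hr.1⟩
  · intro ω ⟨h1, h2, h3⟩ hR hM
    exact topBotS_of_conn Z₁ st x y z ω hR (RdS_trans_st Z₁ st ω ((RdS_comm Z₁ st ω x y).mp hR) h1) h1 hM h3 h2

/-- **THE CLASS `(s₁,s₃)` IS DOMINATED** on any status. -/
theorem class13S_le_topBotS {V : (E₁ → Bool) → Prop} (hV : UpSet V) :
    (univ.filter fun ω : E₁ → Bool => V ω ∧ C13S Z₁ st x y z ω).card ≤
      (univ.filter fun ω : E₁ → Bool => V ω ∧ TopBotS Z₁ x y z st ω).card := by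
  let W : (E₁ → Bool) → Prop := fun ω => RdS Z₁ st ω x y ∧ ¬ MgS Z₁ st ω x y ∧ ¬ MgS Z₁ st ω x z
  have hW : UpSet W := fun ω ω' h hle =>
    ⟨RdS_mono_st Z₁ st hle h.1, fun hb => h.2.1 (MgS_anti_st Z₁ st hle hb), fun hb => h.2.2 (MgS_anti_st Z₁ st hle hb)⟩
  refine classS_le_of_shape Z₁ st x y z y z _ W hW ?_ ?_ hV
  · intro ω ⟨hr, hb⟩
    exact ⟨⟨hr.1, hb.1, hb.2.1⟩, hb.2.2, hr.2.2⟩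
  · intro ω ⟨h1, h2, h3⟩ hR hM
    exact topBotS_of_conn Z₁ st x y z ω h1 ((RdS_comm Z₁ st ω z x).mp (RdS_trans_st Z₁ st ω hR
      ((RdS_comm Z₁ st ω x y).mp h1))) hR h2 h3 hM

/-! ## A present mark edge empties the classes in which its pair is connected in neither colour -/

omit [Fintype E₁] [DecidableEq E₁] in
/-- An edge `x–y` empties `(s₂,s₃)`. -/
theorem not_c23_of_edge_xy {e : E₁} (he : presE st e) (hj : Z₁.Joins e x y) (ω : E₁ → Bool) :
    ¬ C23S Z₁ st x y z ω := fun ⟨hr, hb⟩ =>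
  (rdS_or_mgS_of_present Z₁ st ω he hj).elim hr.1 hb.1

omit [Fintype E₁] [DecidableEq E₁] in
/-- An edge `x–y` empties `(s₂,s₃)` (the same class, for the anchored list). -/
theorem not_c13_of_edge_xz {e : E₁} (he : presE st e) (hj : Z₁.Joins e x z) (ω : E₁ → Bool) :
    ¬ C13S Z₁ st x y z ω := fun ⟨hr, hb⟩ =>
  (rdS_or_mgS_of_present Z₁ st ω he hj).elim hr.2.1 hb.2.1

omit [Fintype E₁] [DecidableEq E₁] in
/-- An edge `x–z` empties `(s₃,s₁)`. -/
theorem not_c31_of_edge_xz {e : E₁} (he : presE st e) (hj : Z₁.Joins e x z) (ω : E₁ → Bool) :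
    ¬ C31S Z₁ st x y z ω := fun ⟨hr, hb⟩ =>
  (rdS_or_mgS_of_present Z₁ st ω he hj).elim hr.2.1 hb.2.1

omit [Fintype E₁] [DecidableEq E₁] in
/-- An edge `y–z` empties `(s₁,s₂)`. -/
theorem not_c12_of_edge_yz {e : E₁} (he : presE st e) (hj : Z₁.Joins e y z) (ω : E₁ → Bool) :
    ¬ C12S Z₁ st x y z ω := fun ⟨hr, hb⟩ =>
  (rdS_or_mgS_of_present Z₁ st ω he hj).elim hr.2.2 hb.2.2

/-! ## THEOREM (TWO MARK EDGES) -/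

/-- Two of the three pairs of marks are joined by present edges. -/
def TwoMarkEdges : Prop :=
  ∃ e₁ e₂ : E₁, presE st e₁ ∧ presE st e₂ ∧
    ((Z₁.Joins e₁ x y ∧ Z₁.Joins e₂ x z) ∨ (Z₁.Joins e₁ x y ∧ Z₁.Joins e₂ y z) ∨ (Z₁.Joins e₁ x z ∧ Z₁.Joins e₂ y z))

/-- With edges `x–y` and `x–z`, the crossed classes reduce to `(s₁,s₂)`. -/
theorem cycDominationS_of_edges_xy_xz {e₁ e₂ : E₁} (h₁ : presE st e₁) (hj₁ : Z₁.Joins e₁ x y) (h₂ : presE st e₂)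
    (hj₂ : Z₁.Joins e₂ x z) : CycDominationS Z₁ x y z st := by
  intro V hV
  refine (card_filter_congr' fun ω _ => and_congr_right fun _ => ?_).trans_le (class12S_le_topBotS Z₁ st x y z hV)
  rw [cycCrossedS_iff_classes]
  exact ⟨fun h => h.elim id fun h => h.elim (fun h => absurd h (not_c23_of_edge_xy Z₁ st x y z h₁ hj₁ ω))
    (fun h => absurd h (not_c31_of_edge_xz Z₁ st x y z h₂ hj₂ ω)), Or.inl⟩

/-- With edges `x–y` and `y–z`, the crossed classes reduce to `(s₃,s₁)`. -/
theorem cycDominationS_of_edges_xy_yz {e₁ e₂ : E₁} (h₁ : presE st e₁) (hj₁ : Z₁.Joins e₁ x y) (h₂ : presE st e₂)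
    (hj₂ : Z₁.Joins e₂ y z) : CycDominationS Z₁ x y z st := by
  intro V hV
  refine (card_filter_congr' fun ω _ => and_congr_right fun _ => ?_).trans_le (class31S_le_topBotS Z₁ st x y z hV)
  rw [cycCrossedS_iff_classes]
  exact ⟨fun h => h.elim (fun h => absurd h (not_c12_of_edge_yz Z₁ st x y z h₂ hj₂ ω)) fun h => h.elim
    (fun h => absurd h (not_c23_of_edge_xy Z₁ st x y z h₁ hj₁ ω)) id, fun h => Or.inr (Or.inr h)⟩

/-- With edges `x–z` and `y–z`, the crossed classes reduce to `(s₂,s₃)`. -/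
theorem cycDominationS_of_edges_xz_yz {e₁ e₂ : E₁} (h₁ : presE st e₁) (hj₁ : Z₁.Joins e₁ x z) (h₂ : presE st e₂)
    (hj₂ : Z₁.Joins e₂ y z) : CycDominationS Z₁ x y z st := by
  intro V hV
  refine (card_filter_congr' fun ω _ => and_congr_right fun _ => ?_).trans_le (class23S_le_topBotS Z₁ st x y z hV)
  rw [cycCrossedS_iff_classes]
  exact ⟨fun h => h.elim (fun h => absurd h (not_c12_of_edge_yz Z₁ st x y z h₂ hj₂ ω)) fun h => h.elim id
    (fun h => absurd h (not_c31_of_edge_xz Z₁ st x y z h₁ hj₁ ω)), fun h => Or.inr (Or.inl h)⟩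

/-- **THEOREM (TWO MARK EDGES)**: on a status with present edges joining two of the three pairs of marks, CONJECTURE
(STOCHASTIC DOMINATION) holds. -/
theorem cycDominationS_of_twoMarkEdges (h : TwoMarkEdges Z₁ st x y z) : CycDominationS Z₁ x y z st := by
  obtain ⟨e₁, e₂, h₁, h₂, hc⟩ := h
  rcases hc with ⟨hj₁, hj₂⟩ | ⟨hj₁, hj₂⟩ | ⟨hj₁, hj₂⟩
  · exact cycDominationS_of_edges_xy_xz Z₁ st x y z h₁ hj₁ h₂ hj₂
  · exact cycDominationS_of_edges_xy_yz Z₁ st x y z h₁ hj₁ h₂ hj₂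
  · exact cycDominationS_of_edges_xz_yz Z₁ st x y z h₁ hj₁ h₂ hj₂

/-- **THEOREM (TWO MARK EDGES)**, all-free form: a host with edges joining two of the three pairs of marks satisfies
the conjecture. -/
theorem cycDomination_of_twoMarkEdges (h : TwoMarkEdges Z₁ (fun _ => EStat.free) x y z) : CycDomination Z₁ x y z :=
  (cycDominationS_free Z₁ x y z).mp (cycDominationS_of_twoMarkEdges Z₁ _ x y z h)

/-- With edges `x–y` and `x–z`, the anchored crossed classes reduce to `(s₁,s₂)`. -/
theorem ancDominationS_of_edges_xy_xz {e₁ e₂ : E₁} (h₁ : presE st e₁) (hj₁ : Z₁.Joins e₁ x y) (h₂ : presE st e₂)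
    (hj₂ : Z₁.Joins e₂ x z) : AncDominationS Z₁ x y z st := by
  intro V hV
  refine (card_filter_congr' fun ω _ => and_congr_right fun _ => ?_).trans_le (class12S_le_topBotS Z₁ st x y z hV)
  rw [ancCrossedS_iff_classes]
  exact ⟨fun h => h.elim id fun h => h.elim (fun h => absurd h (not_c23_of_edge_xy Z₁ st x y z h₁ hj₁ ω))
    (fun h => absurd h (not_c13_of_edge_xz Z₁ st x y z h₂ hj₂ ω)), Or.inl⟩

/-- With edges `x–y` and `y–z`, the anchored crossed classes reduce to `(s₁,s₃)`. -/
theorem ancDominationS_of_edges_xy_yz {e₁ e₂ : E₁} (h₁ : presE st e₁) (hj₁ : Z₁.Joins e₁ x y) (h₂ : presE st e₂)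
    (hj₂ : Z₁.Joins e₂ y z) : AncDominationS Z₁ x y z st := by
  intro V hV
  refine (card_filter_congr' fun ω _ => and_congr_right fun _ => ?_).trans_le (class13S_le_topBotS Z₁ st x y z hV)
  rw [ancCrossedS_iff_classes]
  exact ⟨fun h => h.elim (fun h => absurd h (not_c12_of_edge_yz Z₁ st x y z h₂ hj₂ ω)) fun h => h.elim
    (fun h => absurd h (not_c23_of_edge_xy Z₁ st x y z h₁ hj₁ ω)) id, fun h => Or.inr (Or.inr h)⟩

/-- With edges `x–z` and `y–z`, the anchored crossed classes reduce to `(s₂,s₃)`. -/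
theorem ancDominationS_of_edges_xz_yz {e₁ e₂ : E₁} (h₁ : presE st e₁) (hj₁ : Z₁.Joins e₁ x z) (h₂ : presE st e₂)
    (hj₂ : Z₁.Joins e₂ y z) : AncDominationS Z₁ x y z st := by
  intro V hV
  refine (card_filter_congr' fun ω _ => and_congr_right fun _ => ?_).trans_le (class23S_le_topBotS Z₁ st x y z hV)
  rw [ancCrossedS_iff_classes]
  exact ⟨fun h => h.elim (fun h => absurd h (not_c12_of_edge_yz Z₁ st x y z h₂ hj₂ ω)) fun h => h.elim id
    (fun h => absurd h (not_c13_of_edge_xz Z₁ st x y z h₁ hj₁ ω)), fun h => Or.inr (Or.inl h)⟩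

/-- **THEOREM (TWO MARK EDGES)** for the anchored orientation. -/
theorem ancDominationS_of_twoMarkEdges (h : TwoMarkEdges Z₁ st x y z) : AncDominationS Z₁ x y z st := by
  obtain ⟨e₁, e₂, h₁, h₂, hc⟩ := h
  rcases hc with ⟨hj₁, hj₂⟩ | ⟨hj₁, hj₂⟩ | ⟨hj₁, hj₂⟩
  · exact ancDominationS_of_edges_xy_xz Z₁ st x y z h₁ hj₁ h₂ hj₂
  · exact ancDominationS_of_edges_xy_yz Z₁ st x y z h₁ hj₁ h₂ hj₂
  · exact ancDominationS_of_edges_xz_yz Z₁ st x y z h₁ hj₁ h₂ hj₂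

/-- **THEOREM (TWO MARK EDGES)** for the anchored orientation, all-free form. -/
theorem ancDomination_of_twoMarkEdges (h : TwoMarkEdges Z₁ (fun _ => EStat.free) x y z) :
    AncDomination Z₁ y z x :=
  (ancDominationS_free Z₁ x y z).mp (ancDominationS_of_twoMarkEdges Z₁ _ x y z h)

end Counts

end MultiExit

end ZoneZ

end PercRepro
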